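import Mathlib.Algebra.Order.Antidiag.FinsuppEquiv
import Mathlib.Data.Finsupp.Lex
import Mathlib.Order.Fin.Finset
import Literature.Barriers.ValiantsHypothesis.PartialDerivativesDetPerm
import Literature.Barriers.ValiantsHypothesis.ShiftedPartialsMonotone
import Literature.Barriers.ValiantsHypothesis.ShiftedPartialsTwoPowers
import HarnessLib

/-!
# Shifted partial derivatives: the Gupta–Kamath–Kayal–Saptharishi lower bound for the determinant
(Case C4 of Efremenko–Landsberg–Schenck–Weyman's Theorem 1.5)

Support file for the barrier entry `ShiftedPartialDerivatives.lean` (`ShiftedPartialsCannotSeparate`,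
ELSW Thm. 1.5). ELSW §6 (Case C4): "We use a lower bound on `I^{det_n,k}_{n-k+τ}` from [GKKS]: ... If an
ideal is generated by `f₁, …, f_q` in degree `n-k`, then in degree `n-k+τ`, its dimension is at least
the number of monomials in degree `n-k+τ` that contain a leading monomial from one of the `f_j`. If we
order the variables in `ℂ^{n²}` by `x¹₁ > x¹₂ > ⋯ > xⁿ_n`, then the leading monomial of any minor is the
product of the elements on the principal diagonal. Even this is difficult to estimate, so in [GKKS]
they restrict further to only look at leading monomials among the variables on the diagonal and
super diagonal ... Among these, they compute that the number of leading monomials of degree `n-k` is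
`binom(n+k, 2k)` ... in degree `n-k+τ` the dimension of this ideal is bounded below by
`binom(n+k,2k) binom(n²+τ-2k, τ)`." The source computation is GKKS (J. ACM 61 (2014)), §5: Prop. 11
(`dim span S = #{LM(f)}`, "a simple application of Gaussian elimination"), Cor. 12–13, Lemma 14 (the
companions device: "adding any subset `T ⊆ Q'` to `Q` does not alter the leading increasing
sequence"; `n² - (2n-1) + r + (r-1)` usable variables), Lemma 15 (`S₂(n,r) = binom(2n-r, r)`), Cor. 16.

**Proved here** (`gkks_bound`, any field, `k ≤ n`, `1 ≤ n`, every `τ`):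
`binom(n+k, 2k) · binom(n² - 2k + τ - 1, τ) ≤ rank((det_n)_{(k,n-k)[τ]})`. GKKS/ELSW count monomials of
degree AT MOST `n-k+ℓ` and print `binom(n²+τ-2k, τ)`; the tree's rank is in exact degree `n-k+τ`, where
the same argument gives the exact-degree count `binom(n²-2k+τ-1, τ)` (monomials of degree exactly `τ`
in `n² - 2k` variables). Construction: positions `Fin (2n-1)` of the chain `x₀₀, x₀₁, x₁₁, x₁₂, …`
(`chainCell`); an `(n-k)`-increasing sequence in the two diagonals = a SPARSE set `Q` of positions (no two
consecutive, `IsSparse`; counted by `choose_le_card_sparse`, the bijection of GKKS Lemma 15); its minor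
`qMinor` (the tree's `gen`, a `k`-th partial of `det_n`, `qMinor_mem_derivSet`) has LEADING monomial
`qMono Q` = the product of the cells of `Q` for the lexicographic order with `x₀₀` most significant
(`key`, `key_lt_key_qMono` — GKKS: "the leading monomial ... is just the product of the variables in an
`(n-k)`-increasing sequence"); shifting by monomials `x^β` in the allowed variables (`allowed`: off the
diagonals, the cells of `Q`, their chain successors = GKKS's companions) keeps `β + qMono Q` decodable
(`eq_of_add_qMono_eq`, via the parity decoding `dec`), so the shifted minors have pairwise distinct
leading monomials and are linearly independent (`linearIndependent_of_key`, Prop. 11); counting gives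
the bound.

## References

* [GuptaKamathKayalSaptharishi2014] A. Gupta, P. Kamath, N. Kayal, R. Saptharishi, *Approaching the
  chasm at depth four*, J. ACM 61 (2014), §5 (Prop. 11, Cor. 12–13, Lemmas 14–15, Cor. 16).
* [EfremenkoLandsbergSchenckWeyman2018] K. Efremenko, J. M. Landsberg, H. Schenck, J. Weyman, *The
  method of shifted partial derivatives cannot separate the permanent from the determinant*, Math.
  Comp. 87 (2018), §6 (Case C4).
-/

noncomputable section

namespace Literature.Barriers.ValiantsHypothesis

open MvPolynomial Finset

/-! ### Sparse subsets of a path and their decoding -/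

section Sparse

/-- A set of positions on a path is SPARSE if no two of its elements are consecutive (an `r`-increasing
sequence inside the two central diagonals, GKKS Lemma 15: "picking `r` of the `(2n-1)` variables such
that no two adjacent variables are chosen"). [cite: GuptaKamathKayalSaptharishi2014, §5 (Lemma 14–15)] -/
def IsSparse {L : ℕ} (Q : Finset (Fin L)) : Prop := ∀ p ∈ Q, ∀ q ∈ Q, p.val + 1 ≠ q.val

/-- Sparseness is decidable. [folklore] -/
instance {L : ℕ} (Q : Finset (Fin L)) : Decidable (IsSparse Q) := by
  unfold IsSparse; infer_instance

/-- The decoding predicate: `dec S 0 = [0 ∈ S]`, `dec S (p+1) = [p+1 ∈ S] ∧ ¬ dec S p` (greedy/parity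
reading of a sparse set from a superset inside it and its successors). [folklore] -/
def dec (S : ℕ → Prop) : ℕ → Prop
  | 0 => S 0
  | p + 1 => S (p + 1) ∧ ¬ dec S p

/-- A sparse `Q` is recovered by `dec` from any `S` with `Q ⊆ S ⊆ Q ∪ succ Q` — GKKS Lemma 14: "adding any
subset `T ⊆ Q'` to `Q` does not alter the leading increasing sequence". [cite: GuptaKamathKayalSaptharishi2014, §5 (Lemma 14–15)] -/
theorem dec_iff {L : ℕ} {Q : Finset (Fin L)} (hQ : IsSparse Q) {S : ℕ → Prop}
    (hQS : ∀ p ∈ Q, S p.val) (hSQ : ∀ m : ℕ, S m → (∃ p ∈ Q, p.val = m) ∨ (∃ p ∈ Q, p.val + 1 = m)) :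
    ∀ m : ℕ, dec S m ↔ ∃ p ∈ Q, p.val = m := by
  intro m
  induction m with
  | zero =>
    simp only [dec]
    constructor
    · intro h
      rcases hSQ 0 h with h' | ⟨p, -, hp⟩
      · exact h'
      · omega
    · rintro ⟨p, hp, hp0⟩
      exact hp0 ▸ hQS p hp
  | succ m ih =>
    simp only [dec]
    rw [ih]
    constructor
    · rintro ⟨hS, hnot⟩
      rcases hSQ _ hS with h' | ⟨p, hp, hpm⟩
      · exact h'
      · exact (hnot ⟨p, hp, by omega⟩).elim
    · rintro ⟨p, hp, hpm⟩
      refine ⟨hpm ▸ hQS p hp, ?_⟩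
      rintro ⟨q, hq, hqm⟩
      exact hQ q hq p hp (by omega)

/-- Hence two sparse sets squeezed by the same `S` coincide. [folklore] -/
theorem eq_of_sparse_of_subset {L : ℕ} {Q Q' : Finset (Fin L)} (hQ : IsSparse Q) (hQ' : IsSparse Q')
    {S : ℕ → Prop} (hQS : ∀ p ∈ Q, S p.val)
    (hSQ : ∀ m : ℕ, S m → (∃ p ∈ Q, p.val = m) ∨ (∃ p ∈ Q, p.val + 1 = m))
    (hQS' : ∀ p ∈ Q', S p.val)
    (hSQ' : ∀ m : ℕ, S m → (∃ p ∈ Q', p.val = m) ∨ (∃ p ∈ Q', p.val + 1 = m)) : Q = Q' := by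
  ext q
  have h1 := dec_iff hQ hQS hSQ q.val
  have h2 := dec_iff hQ' hQS' hSQ' q.val
  constructor
  · intro hq
    obtain ⟨p, hp, hpq⟩ := (h1.symm.trans h2).1 ⟨q, hq, rfl⟩
    rwa [← Fin.ext hpq]
  · intro hq
    obtain ⟨p, hp, hpq⟩ := (h2.symm.trans h1).1 ⟨q, hq, rfl⟩
    rwa [← Fin.ext hpq]

/-! ### Counting sparse sets: an injection from `s`-subsets of `Fin (L + 1 - s)` -/

/-- Spreading an `s`-subset `T` of `Fin M`: its `i`-th smallest element moved up by `i` (the bijection of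
GKKS Lemma 15 between `r`-subsets of `2n-r` things and sparse `r`-subsets of the chain). [cite: GuptaKamathKayalSaptharishi2014, §5 (Lemma 14–15)] -/
def spread {M s : ℕ} (L : ℕ) (hML : M + s ≤ L + 1) (T : Finset (Fin M)) (hT : T.card = s) :
    Finset (Fin L) :=
  Finset.univ.image fun i : Fin s => (⟨(T.orderEmbOfFin hT i).val + i.val, by
    have := (T.orderEmbOfFin hT i).2; have := i.2; omega⟩ : Fin L)

/-- The spread enumeration is strictly increasing. [folklore] -/
theorem spread_strictMono {M s : ℕ} (L : ℕ) (hML : M + s ≤ L + 1) (T : Finset (Fin M))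
    (hT : T.card = s) : StrictMono fun i : Fin s => (⟨(T.orderEmbOfFin hT i).val + i.val, by
      have := (T.orderEmbOfFin hT i).2; have := i.2; omega⟩ : Fin L) := by
  intro i j hij
  have h := (T.orderEmbOfFin hT).strictMono hij
  rw [Fin.lt_def] at h hij ⊢
  simp only
  omega

/-- The spread has `s` elements. [folklore] -/
theorem card_spread {M s : ℕ} (L : ℕ) (hML : M + s ≤ L + 1) (T : Finset (Fin M)) (hT : T.card = s) :
    (spread L hML T hT).card = s := by
  rw [spread, Finset.card_image_of_injective _ (spread_strictMono L hML T hT).injective,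
    Finset.card_univ, Fintype.card_fin]

/-- The spread is sparse. [folklore] -/
theorem isSparse_spread {M s : ℕ} (L : ℕ) (hML : M + s ≤ L + 1) (T : Finset (Fin M))
    (hT : T.card = s) : IsSparse (spread L hML T hT) := by
  intro p hp q hq
  rw [spread, Finset.mem_image] at hp hq
  obtain ⟨i, -, rfl⟩ := hp
  obtain ⟨j, -, rfl⟩ := hq
  simp only
  intro h
  rcases lt_trichotomy i j with hij | rfl | hij
  · have := (T.orderEmbOfFin hT).strictMono hij
    rw [Fin.lt_def] at this hij
    omega
  · omega
  · have := (T.orderEmbOfFin hT).strictMono hij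
    rw [Fin.lt_def] at this hij
    omega

/-- Spreading is injective. [folklore] -/
theorem spread_injective {M s : ℕ} (L : ℕ) (hML : M + s ≤ L + 1) {T T' : Finset (Fin M)}
    (hT : T.card = s) (hT' : T'.card = s) (h : spread L hML T hT = spread L hML T' hT') : T = T' := by
  -- the sorted enumerations of the two spreads coincide, hence so do those of `T` and `T'`
  have key : ∀ i : Fin s, (T.orderEmbOfFin hT i).val = (T'.orderEmbOfFin hT' i).val := by
    have e1 := Finset.orderEmbOfFin_unique (s := spread L hML T hT) (card_spread L hML T hT)
      (f := fun i : Fin s => (⟨(T.orderEmbOfFin hT i).val + i.val, by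
        have := (T.orderEmbOfFin hT i).2; have := i.2; omega⟩ : Fin L))
      (fun i => by rw [spread]; exact Finset.mem_image_of_mem _ (Finset.mem_univ _))
      (spread_strictMono L hML T hT)
    have e2 := Finset.orderEmbOfFin_unique (s := spread L hML T' hT') (card_spread L hML T' hT')
      (f := fun i : Fin s => (⟨(T'.orderEmbOfFin hT' i).val + i.val, by
        have := (T'.orderEmbOfFin hT' i).2; have := i.2; omega⟩ : Fin L))
      (fun i => by rw [spread]; exact Finset.mem_image_of_mem _ (Finset.mem_univ _))
      (spread_strictMono L hML T' hT')
    intro i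
    have h1 := congrFun e1 i
    have h2 := congrFun e2 i
    have : (spread L hML T hT).orderEmbOfFin (card_spread L hML T hT) i =
        (spread L hML T' hT').orderEmbOfFin (card_spread L hML T' hT') i := by
      congr 1; simp [h]
    have h3 := congrArg Fin.val (h1.trans (this.trans h2.symm))
    simp only at h3
    omega
  ext x
  constructor
  · intro hx
    obtain ⟨i, hi⟩ : ∃ i, T.orderEmbOfFin hT i = x := by
      have := Finset.range_orderEmbOfFin T hT
      rw [Set.ext_iff] at this
      exact (this x).2 hx
    rw [← hi, show T.orderEmbOfFin hT i = T'.orderEmbOfFin hT' i from Fin.ext (key i)]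
    exact Finset.orderEmbOfFin_mem T' hT' i
  · intro hx
    obtain ⟨i, hi⟩ : ∃ i, T'.orderEmbOfFin hT' i = x := by
      have := Finset.range_orderEmbOfFin T' hT'
      rw [Set.ext_iff] at this
      exact (this x).2 hx
    rw [← hi, show T'.orderEmbOfFin hT' i = T.orderEmbOfFin hT i from Fin.ext (key i).symm]
    exact Finset.orderEmbOfFin_mem T hT i

/-- There are at least `binom(L + 1 - s, s)` sparse `s`-subsets of `Fin L` (GKKS Lemma 15 states equality,
`S₂(n,r) = binom(2n-r, r)` for `L = 2n-1`). [cite: GuptaKamathKayalSaptharishi2014, §5 (Lemma 14–15)] -/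
theorem choose_le_card_sparse (L s : ℕ) (hs : s ≤ L + 1) :
    (L + 1 - s).choose s ≤ ((Finset.univ : Finset (Finset (Fin L))).filter
      (fun Q => IsSparse Q ∧ Q.card = s)).card := by
  classical
  set M := L + 1 - s with hM
  have hML : M + s ≤ L + 1 := by omega
  -- the source: `s`-subsets of `Fin M`
  have hsrc : ((Finset.univ : Finset (Fin M)).powersetCard s).card = M.choose s := by
    rw [Finset.card_powersetCard, Finset.card_univ, Fintype.card_fin]
  rw [← hsrc]
  refine Finset.card_le_card_of_injOn (fun T => if hT : T.card = s then spread L hML T hT else ∅)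
    ?_ ?_
  · intro T hT
    rw [Finset.mem_coe, Finset.mem_powersetCard] at hT
    simp only [dif_pos hT.2, Finset.mem_coe, Finset.mem_filter]
    exact ⟨Finset.mem_univ _, isSparse_spread L hML T hT.2, card_spread L hML T hT.2⟩
  · intro T hT T' hT' h
    rw [Finset.mem_coe, Finset.mem_powersetCard] at hT hT'
    simp only [dif_pos hT.2, dif_pos hT'.2] at h
    exact spread_injective L hML hT.2 hT'.2 h

end Sparse

/-! ### The two central diagonals and the row-major key -/

section Chain

variable {n : ℕ}

/-- The cell of the diagonal/superdiagonal chain `D_{2,n} = {x_{ii}} ∪ {x_{i,i+1}}` at position `p`: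
`2i ↦ (i,i)`, `2i+1 ↦ (i,i+1)`. [cite: GuptaKamathKayalSaptharishi2014, §5.1] -/
def chainCell (n : ℕ) (p : Fin (2 * n - 1)) : Fin n × Fin n :=
  (⟨p.val / 2, by omega⟩, ⟨(p.val + 1) / 2, by omega⟩)

/-- Positions two apart give cells with strictly increasing row and column. [folklore] -/
theorem chainCell_lt_of_le {p q : Fin (2 * n - 1)} (h : p.val + 2 ≤ q.val) :
    (chainCell n p).1 < (chainCell n q).1 ∧ (chainCell n p).2 < (chainCell n q).2 := by
  simp only [chainCell, Fin.lt_def]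
  omega

/-- Distinct positions give distinct cells. [folklore] -/
theorem chainCell_injective (n : ℕ) : Function.Injective (chainCell n) := by
  intro p q h
  simp only [chainCell, Prod.mk.injEq, Fin.mk.injEq] at h
  apply Fin.ext; omega

/-- In a sparse set, distinct positions differ by at least two. [folklore] -/
theorem two_le_of_sparse {L : ℕ} {Q : Finset (Fin L)} (hQ : IsSparse Q) {p q : Fin L} (hp : p ∈ Q)
    (hq : q ∈ Q) (hlt : p < q) : p.val + 2 ≤ q.val := by
  have := hQ p hp q hq
  rw [Fin.lt_def] at hlt
  omega

/-- The row-major index `r·n + c` of a cell (GKKS's variable order `x₁₁ ≻ x₁₂ ≻ ⋯ ≻ x_{nn}`: smaller index =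
more significant). [cite: GuptaKamathKayalSaptharishi2014, §5] -/
def rowMajor (n : ℕ) (v : Fin n × Fin n) : ℕ := v.1.val * n + v.2.val

/-- The row-major index is injective. [folklore] -/
theorem rowMajor_injective (n : ℕ) : Function.Injective (rowMajor n) := by
  intro v w h
  simp only [rowMajor] at h
  have h1 := v.2.2; have h2 := w.2.2
  have hr : v.1.val = w.1.val := by
    by_contra hne
    rcases Nat.lt_or_gt_of_ne hne with hlt | hlt <;> nlinarith
  have hc : v.2.val = w.2.val := by rw [hr] at h; omega
  exact Prod.ext (Fin.ext hr) (Fin.ext hc)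

/-- A smaller row gives a smaller row-major index. [folklore] -/
theorem rowMajor_lt_of_fst_lt {v w : Fin n × Fin n} (h : v.1 < w.1) : rowMajor n v < rowMajor n w := by
  simp only [rowMajor]
  rw [Fin.lt_def] at h
  have := v.2.2
  nlinarith

/-- Same row, smaller column gives a smaller row-major index. [folklore] -/
theorem rowMajor_lt_of_fst_eq_snd_lt {v w : Fin n × Fin n} (h1 : v.1 = w.1) (h2 : v.2 < w.2) :
    rowMajor n v < rowMajor n w := by
  simp only [rowMajor, h1]
  rw [Fin.lt_def] at h2
  omega

/-- A smaller row-major index has a row at most as large. [folklore] -/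
theorem fst_le_of_rowMajor_lt {v w : Fin n × Fin n} (h : rowMajor n v < rowMajor n w) : v.1 ≤ w.1 := by
  by_contra hlt
  exact absurd h (not_lt.2 (rowMajor_lt_of_fst_lt (not_le.1 hlt)).le)

/-- The key of a monomial: its exponent vector re-indexed by the row-major order, compared
lexicographically (the most significant variable is `x₀₀`, then `x₀₁`, …: GKKS's order
`x₁₁ ≻ x₁₂ ≻ ⋯ ≻ x_{nn}`). [cite: GuptaKamathKayalSaptharishi2014, §5] -/
def key (n : ℕ) (d : (Fin n × Fin n) →₀ ℕ) : Lex (ℕ →₀ ℕ) := toLex (d.mapDomain (rowMajor n))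

/-- The key is additive. [folklore] -/
theorem key_add (d e : (Fin n × Fin n) →₀ ℕ) : key n (d + e) = key n d + key n e := by
  simp only [key, Finsupp.mapDomain_add]; rfl

/-- The key at the index of a cell is the exponent of that cell. [folklore] -/
theorem ofLex_key_apply (d : (Fin n × Fin n) →₀ ℕ) (v : Fin n × Fin n) :
    ofLex (key n d) (rowMajor n v) = d v := by
  simp only [key, ofLex_toLex]
  exact Finsupp.mapDomain_apply (rowMajor_injective n) d v

/-- The key vanishes off the row-major indices. [folklore] -/
theorem ofLex_key_apply_of_forall_ne (d : (Fin n × Fin n) →₀ ℕ) {j : ℕ} (hj : ∀ v, rowMajor n v ≠ j) :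
    ofLex (key n d) j = 0 := by
  simp only [key, ofLex_toLex]
  exact Finsupp.mapDomain_notin_range d j (by rintro ⟨v, rfl⟩; exact hj v rfl)

/-- The key is injective. [folklore] -/
theorem key_injective (n : ℕ) : Function.Injective (key n) := by
  intro d e h
  ext v
  rw [← ofLex_key_apply d v, ← ofLex_key_apply e v, h]

end Chain

/-! ### The minor attached to a sparse position set, and its leading monomial -/

section Minor

variable {K : Type*} [Field K] {n k : ℕ}

/-- The rows of the cells of `Q`. [folklore] -/
def qRows (Q : Finset (Fin (2 * n - 1))) : Finset (Fin n) := Q.image fun p => (chainCell n p).1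

/-- The columns of the cells of `Q`. [folklore] -/
def qCols (Q : Finset (Fin (2 * n - 1))) : Finset (Fin n) := Q.image fun p => (chainCell n p).2

/-- For sparse `Q`, distinct positions have distinct rows. [folklore] -/
theorem fst_injOn_of_sparse {Q : Finset (Fin (2 * n - 1))} (hQ : IsSparse Q) :
    Set.InjOn (fun p => (chainCell n p).1) Q := by
  intro p hp q hq h
  by_contra hne
  rcases lt_or_gt_of_ne hne with hlt | hlt
  · exact absurd h (ne_of_lt (chainCell_lt_of_le (two_le_of_sparse hQ hp hq hlt)).1)
  · exact absurd h (ne_of_gt (chainCell_lt_of_le (two_le_of_sparse hQ hq hp hlt)).1)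

/-- For sparse `Q`, distinct positions have distinct columns. [folklore] -/
theorem snd_injOn_of_sparse {Q : Finset (Fin (2 * n - 1))} (hQ : IsSparse Q) :
    Set.InjOn (fun p => (chainCell n p).2) Q := by
  intro p hp q hq h
  by_contra hne
  rcases lt_or_gt_of_ne hne with hlt | hlt
  · exact absurd h (ne_of_lt (chainCell_lt_of_le (two_le_of_sparse hQ hp hq hlt)).2)
  · exact absurd h (ne_of_gt (chainCell_lt_of_le (two_le_of_sparse hQ hq hp hlt)).2)

/-- `Q` has `|Q|` rows. [folklore] -/
theorem card_qRows {Q : Finset (Fin (2 * n - 1))} (hQ : IsSparse Q) : (qRows Q).card = Q.card :=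
  Finset.card_image_of_injOn (fst_injOn_of_sparse hQ)

/-- `Q` has `|Q|` columns. [folklore] -/
theorem card_qCols {Q : Finset (Fin (2 * n - 1))} (hQ : IsSparse Q) : (qCols Q).card = Q.card :=
  Finset.card_image_of_injOn (snd_injOn_of_sparse hQ)

/-- The pair (complementary rows, complementary columns) of `k`-sets indexing the minor of `Q` in the
tree's `PairIdx`. [folklore] -/
def qPair (Q : Finset (Fin (2 * n - 1))) (hQ : IsSparse Q) (hcard : Q.card + k = n) : PairIdx n k :=
  (⟨(qRows Q)ᶜ, by rw [Finset.card_compl, card_qRows hQ, Fintype.card_fin]; omega⟩,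
   ⟨(qCols Q)ᶜ, by rw [Finset.card_compl, card_qCols hQ, Fintype.card_fin]; omega⟩)

variable (K) in
/-- The minor of `det_n` on the rows and columns of the cells of `Q` — a `k`-th partial derivative of
`det_n` (the tree's canonical derivative `gen`), GKKS's `(n-k) × (n-k)` minor `M`. [cite: GuptaKamathKayalSaptharishi2014, §5 (Cor. 12–13)] -/
def qMinor (Q : Finset (Fin (2 * n - 1))) (hQ : IsSparse Q) (hcard : Q.card + k = n) :
    MvPolynomial (Fin n × Fin n) K :=
  gen (fun π => ((Equiv.Perm.sign π : ℤ) : K)) (qPair Q hQ hcard)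

/-- The minor of `Q` is an order-`k` partial derivative of `det_n`. [folklore] -/
theorem qMinor_mem_derivSet (Q : Finset (Fin (2 * n - 1))) (hQ : IsSparse Q) (hcard : Q.card + k = n) :
    qMinor K Q hQ hcard ∈ derivSet k (Literature.Computability.AlgebraicComplexity.detPoly (Fin n) K) := by
  rw [detPoly_eq_permSum]
  exact gen_mem_derivSet _ _

/-- The designated (leading) monomial of the minor of `Q`: the product of the variables of the cells of `Q`
("the leading monomial of any `(n-k) × (n-k)` minor is just the product of the variables along the
principal diagonal"). [cite: GuptaKamathKayalSaptharishi2014, §5] -/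
def qMono (Q : Finset (Fin (2 * n - 1))) : (Fin n × Fin n) →₀ ℕ := sqfree (Q.image (chainCell n))

/-- The position of `Q` sitting in a given column. [folklore] -/
theorem exists_pos_of_mem_qCols {Q : Finset (Fin (2 * n - 1))} {b : Fin n} (hb : b ∈ qCols Q) :
    ∃ p ∈ Q, (chainCell n p).2 = b := by
  simpa [qCols] using hb

/-- The matching permutation: the column of each cell of `Q` goes to its row, the complementary columns as
the representative permutation of the pair (exists; extends two bijections between complementary sets). [folklore] -/
theorem exists_matchingPerm (Q : Finset (Fin (2 * n - 1))) (hQ : IsSparse Q) (hcard : Q.card + k = n) :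
    ∃ π₁ : Equiv.Perm (Fin n), (∀ p ∈ Q, π₁ (chainCell n p).2 = (chainCell n p).1) ∧
      ∀ b ∈ (qCols Q)ᶜ, π₁ b = reprPerm (qPair Q hQ hcard) b := by
  classical
  set π₀ := reprPerm (qPair Q hQ hcard) with hπ₀
  have hspec : ((qCols Q)ᶜ).map π₀.toEmbedding = (qRows Q)ᶜ := reprPerm_spec (qPair Q hQ hcard)
  have hπ₀B : ∀ b, b ∉ qCols Q → π₀ b ∉ qRows Q := by
    intro b hb
    have : π₀ b ∈ ((qCols Q)ᶜ).map π₀.toEmbedding :=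
      Finset.mem_map_of_mem _ (Finset.mem_compl.2 hb)
    rw [hspec, Finset.mem_compl] at this
    exact this
  let g : Fin n → Fin n := fun b =>
    if hb : b ∈ qCols Q then (chainCell n (exists_pos_of_mem_qCols hb).choose).1 else π₀ b
  have hg_col : ∀ p ∈ Q, g (chainCell n p).2 = (chainCell n p).1 := by
    intro p hp
    have hb : (chainCell n p).2 ∈ qCols Q := Finset.mem_image_of_mem _ hp
    simp only [g, dif_pos hb]
    have hc := (exists_pos_of_mem_qCols hb).choose_spec
    have : (exists_pos_of_mem_qCols hb).choose = p := snd_injOn_of_sparse hQ hc.1 hp hc.2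
    rw [this]
  have hg_B : ∀ b, b ∉ qCols Q → g b = π₀ b := fun b hb => by simp only [g, dif_neg hb]
  have hg_inj : Function.Injective g := by
    intro b b' h
    by_cases hb : b ∈ qCols Q <;> by_cases hb' : b' ∈ qCols Q
    · obtain ⟨p, hp, rfl⟩ := exists_pos_of_mem_qCols hb
      obtain ⟨p', hp', rfl⟩ := exists_pos_of_mem_qCols hb'
      rw [hg_col p hp, hg_col p' hp'] at h
      rw [fst_injOn_of_sparse hQ hp hp' h]
    · obtain ⟨p, hp, rfl⟩ := exists_pos_of_mem_qCols hb
      rw [hg_col p hp, hg_B b' hb'] at h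
      exact absurd (Finset.mem_image_of_mem (fun p => (chainCell n p).1) hp) (h ▸ hπ₀B b' hb')
    · obtain ⟨p', hp', rfl⟩ := exists_pos_of_mem_qCols hb'
      rw [hg_col p' hp', hg_B b hb] at h
      exact absurd (Finset.mem_image_of_mem (fun p => (chainCell n p).1) hp') (h ▸ hπ₀B b hb)
    · rw [hg_B b hb, hg_B b' hb'] at h
      exact π₀.injective h
  refine ⟨Equiv.ofBijective g (Finite.injective_iff_bijective.1 hg_inj), hg_col, fun b hb => ?_⟩
  exact hg_B b (Finset.mem_compl.1 hb)

/-- The tree's canonical derivative `canon c π₀ B` only depends on the values of `π₀` on `B`. [folklore] -/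
theorem canon_congr {R : Type*} [CommRing R] (c : Equiv.Perm (Fin n) → R) {π₀ π₁ : Equiv.Perm (Fin n)}
    {B : Finset (Fin n)} (h : ∀ b ∈ B, π₁ b = π₀ b) : canon c π₁ B = canon c π₀ B := by
  unfold canon
  rw [Finset.filter_congr (fun π _ => by
    exact ⟨fun hπ b hb => (hπ b hb).trans (h b hb), fun hπ b hb => (hπ b hb).trans (h b hb).symm⟩)]

/-- The transversal of the matching permutation on the columns of `Q` is the set of cells of `Q`. [folklore] -/
theorem offGraph_eq_image {Q : Finset (Fin (2 * n - 1))} {π₁ : Equiv.Perm (Fin n)}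
    (h1 : ∀ p ∈ Q, π₁ (chainCell n p).2 = (chainCell n p).1) :
    offGraph π₁ (qCols Q)ᶜ = Q.image (chainCell n) := by
  ext v
  rw [mem_offGraph, Finset.mem_image, Finset.mem_compl, not_not]
  constructor
  · rintro ⟨hv2, hv1⟩
    obtain ⟨p, hp, hpv⟩ := exists_pos_of_mem_qCols hv2
    refine ⟨p, hp, Prod.ext ?_ hpv⟩
    rw [← hv1, ← hpv, h1 p hp]
  · rintro ⟨p, hp, rfl⟩
    exact ⟨Finset.mem_image_of_mem _ hp, h1 p hp⟩

/-- The designated monomial occurs in the minor with coefficient `±1`. [folklore] -/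
theorem coeff_qMono_qMinor (Q : Finset (Fin (2 * n - 1))) (hQ : IsSparse Q) (hcard : Q.card + k = n) :
    ∃ π₁ : Equiv.Perm (Fin n),
      coeff (qMono Q) (qMinor K Q hQ hcard) = ((Equiv.Perm.sign π₁ : ℤ) : K) := by
  classical
  obtain ⟨π₁, h1, h2⟩ := exists_matchingPerm Q hQ hcard
  refine ⟨π₁, ?_⟩
  change coeff (qMono Q) (canon _ (reprPerm (qPair Q hQ hcard)) (qCols Q)ᶜ) = _
  rw [← canon_congr _ h2, qMono, ← offGraph_eq_image h1, coeff_canon_self]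

/-- ... in particular with a nonzero coefficient. [folklore] -/
theorem coeff_qMono_qMinor_ne_zero (Q : Finset (Fin (2 * n - 1))) (hQ : IsSparse Q)
    (hcard : Q.card + k = n) : coeff (qMono Q) (qMinor K Q hQ hcard) ≠ 0 := by
  obtain ⟨π₁, h⟩ := coeff_qMono_qMinor (K := K) Q hQ hcard
  rw [h]
  rcases Int.units_eq_one_or (Equiv.Perm.sign π₁) with h' | h' <;> simp [h']

/-- The monomials of the minor are the transversals `{(π c, c) : c a column of Q}` of the permutations `π`
agreeing with the matching permutation off the columns of `Q`. [folklore] -/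
theorem exists_perm_of_mem_support {Q : Finset (Fin (2 * n - 1))} (hQ : IsSparse Q) (hcard : Q.card + k = n)
    {π₁ : Equiv.Perm (Fin n)} (h2 : ∀ b ∈ (qCols Q)ᶜ, π₁ b = reprPerm (qPair Q hQ hcard) b)
    {d : (Fin n × Fin n) →₀ ℕ} (hd : d ∈ (qMinor K Q hQ hcard).support) :
    ∃ π : Equiv.Perm (Fin n), (∀ b ∈ (qCols Q)ᶜ, π b = π₁ b) ∧ d = sqfree (offGraph π (qCols Q)ᶜ) := by
  classical
  change d ∈ (canon _ (reprPerm (qPair Q hQ hcard)) (qCols Q)ᶜ).support at hd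
  rw [← canon_congr _ h2] at hd
  unfold canon at hd
  obtain ⟨π, hπ, hdπ⟩ := Finset.mem_biUnion.1 (support_sum hd)
  rw [Finset.mem_filter] at hπ
  refine ⟨π, hπ.2, ?_⟩
  have := support_monomial_subset hdπ
  rwa [Finset.mem_singleton] at this


/-- Such permutations map the columns of `Q` onto the rows of `Q`. [folklore] -/
theorem perm_col_mem_qRows {Q : Finset (Fin (2 * n - 1))} (hQ : IsSparse Q) (hcard : Q.card + k = n)
    {π : Equiv.Perm (Fin n)} (hπ : ∀ b ∈ (qCols Q)ᶜ, π b = reprPerm (qPair Q hQ hcard) b)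
    {p : Fin (2 * n - 1)} (hp : p ∈ Q) : π (chainCell n p).2 ∈ qRows Q := by
  classical
  by_contra hnot
  have hspec : ((qCols Q)ᶜ).map (reprPerm (qPair Q hQ hcard)).toEmbedding = (qRows Q)ᶜ :=
    reprPerm_spec (qPair Q hQ hcard)
  have hmap : ((qCols Q)ᶜ).map π.toEmbedding =
      ((qCols Q)ᶜ).map (reprPerm (qPair Q hQ hcard)).toEmbedding := by
    rw [Finset.map_eq_image, Finset.map_eq_image]
    exact Finset.image_congr fun b hb => hπ b hb
  have : π (chainCell n p).2 ∈ ((qCols Q)ᶜ).map π.toEmbedding := by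
    rw [hmap, hspec, Finset.mem_compl]; exact hnot
  rw [Finset.mem_map] at this
  obtain ⟨b, hb, hbeq⟩ := this
  have hb' : b = (chainCell n p).2 := π.injective hbeq
  exact (Finset.mem_compl.1 hb) (hb' ▸ Finset.mem_image_of_mem _ hp)

/-- **The leading monomial of the minor** (GKKS §5: "the leading monomial under `≻` of any `(n-k) × (n-k)`
P-minor `M` is just the product of the variables along the principal diagonal of `M`", here for the
minors whose diagonal lies in `D_{2,n}`): every other monomial of the minor of `Q` has a smaller key than
the product of the cells of `Q` — compare at the first cell of `Q` (in row-major order) missed by the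
transversal. [cite: GuptaKamathKayalSaptharishi2014, §5 (before Cor. 13)] -/
theorem key_lt_key_qMono {Q : Finset (Fin (2 * n - 1))} (hQ : IsSparse Q) (hcard : Q.card + k = n)
    {d : (Fin n × Fin n) →₀ ℕ} (hd : d ∈ (qMinor K Q hQ hcard).support) (hne : d ≠ qMono Q) :
    key n d < key n (qMono Q) := by
  classical
  obtain ⟨π₁, h1, h2⟩ := exists_matchingPerm Q hQ hcard
  obtain ⟨π, hπB, rfl⟩ := exists_perm_of_mem_support hQ hcard h2 hd
  have hπ0 : ∀ b ∈ (qCols Q)ᶜ, π b = reprPerm (qPair Q hQ hcard) b :=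
    fun b hb => (hπB b hb).trans (h2 b hb)
  -- some cell of `Q` is missed by `π`
  have hbad : (Q.filter fun p => π (chainCell n p).2 ≠ (chainCell n p).1).Nonempty := by
    by_contra hempty
    rw [Finset.not_nonempty_iff_eq_empty, Finset.filter_eq_empty_iff] at hempty
    apply hne
    rw [qMono, ← offGraph_eq_image (π₁ := π) (fun p hp => by simpa using hempty hp)]
  set p₀ := (Q.filter fun p => π (chainCell n p).2 ≠ (chainCell n p).1).min' hbad with hp₀
  obtain ⟨hp₀Q, hp₀bad⟩ := Finset.mem_filter.1 (Finset.min'_mem _ hbad)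
  have hmin : ∀ p ∈ Q, π (chainCell n p).2 ≠ (chainCell n p).1 → p₀ ≤ p :=
    fun p hp hb => Finset.min'_le _ _ (Finset.mem_filter.2 ⟨hp, hb⟩)
  -- below `p₀`, `π` matches the cells
  have hgood : ∀ p ∈ Q, p < p₀ → π (chainCell n p).2 = (chainCell n p).1 := by
    intro p hp hlt
    by_contra hb
    exact absurd (hmin p hp hb) (not_le.2 hlt)
  -- monotonicity of rows along `Q`
  have hrow_mono : ∀ p ∈ Q, ∀ q ∈ Q, p ≤ q → (chainCell n p).1 ≤ (chainCell n q).1 := by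
    intro p hp q hq hle
    rcases eq_or_lt_of_le hle with rfl | hlt
    · exact le_rfl
    · exact (chainCell_lt_of_le (two_le_of_sparse hQ hp hq hlt)).1.le
  set i := rowMajor n (chainCell n p₀) with hi
  rw [Finsupp.Lex.lt_iff]
  refine ⟨i, fun j hj => ?_, ?_⟩
  · -- agreement below `i`
    by_cases hjr : ∃ v, rowMajor n v = j
    · obtain ⟨v, rfl⟩ := hjr
      rw [ofLex_key_apply, ofLex_key_apply, qMono, sqfree_apply, sqfree_apply]
      have hiff : v ∈ offGraph π (qCols Q)ᶜ ↔ v ∈ Q.image (chainCell n) := by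
        constructor
        · intro hv
          rw [mem_offGraph, Finset.mem_compl, not_not] at hv
          obtain ⟨hv2, hv1⟩ := hv
          obtain ⟨p, hp, hpv⟩ := exists_pos_of_mem_qCols hv2
          rw [Finset.mem_image]
          by_cases hmatch : π (chainCell n p).2 = (chainCell n p).1
          · refine ⟨p, hp, Prod.ext ?_ hpv⟩
            rw [← hv1, ← hpv, hmatch]
          · exfalso
            have hp₀p : p₀ ≤ p := hmin p hp hmatch
            obtain ⟨p', hp', hp'v⟩ : ∃ p' ∈ Q, (chainCell n p').1 = π (chainCell n p).2 := by
              simpa [qRows] using perm_col_mem_qRows hQ hcard hπ0 hp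
            rcases lt_or_ge p' p₀ with hlt | hge
            · have := hgood p' hp' hlt
              have hcol : (chainCell n p').2 = (chainCell n p).2 := π.injective (this.trans hp'v)
              have hpp : p' = p := snd_injOn_of_sparse hQ hp' hp hcol
              rw [hpp] at hlt
              exact absurd hp₀p (not_le.2 hlt)
            · have hv1' : v.1 = (chainCell n p').1 := by rw [hp'v, hpv, hv1]
              rcases eq_or_lt_of_le (hrow_mono p₀ hp₀Q p' hp' hge) with heq | hlt
              · have hp'p₀ : p' = p₀ := (fst_injOn_of_sparse hQ hp' hp₀Q heq.symm)
                -- v = (row p₀, col p), p₀ ≤ p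
                rcases eq_or_lt_of_le hp₀p with heq' | hlt'
                · have hveq : v = chainCell n p₀ :=
                    Prod.ext (by rw [hv1', hp'p₀]) (by rw [← hpv, heq'])
                  rw [hveq] at hj
                  exact absurd hj (lt_irrefl _)
                · have : rowMajor n (chainCell n p₀) < rowMajor n v :=
                    rowMajor_lt_of_fst_eq_snd_lt (by rw [hv1', hp'p₀])
                      (by rw [← hpv]; exact (chainCell_lt_of_le (two_le_of_sparse hQ hp₀Q hp hlt')).2)
                  exact absurd hj (not_lt.2 this.le)
              · have : rowMajor n (chainCell n p₀) < rowMajor n v :=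
                  rowMajor_lt_of_fst_lt (by rw [hv1']; exact hlt)
                exact absurd hj (not_lt.2 this.le)
        · intro hv
          rw [Finset.mem_image] at hv
          obtain ⟨p, hp, rfl⟩ := hv
          rw [mem_offGraph, Finset.mem_compl, not_not]
          refine ⟨Finset.mem_image_of_mem _ hp, ?_⟩
          by_contra hb
          have hp₀p := hmin p hp hb
          rcases eq_or_lt_of_le hp₀p with rfl | hlt
          · exact lt_irrefl _ hj
          · have : rowMajor n (chainCell n p₀) < rowMajor n (chainCell n p) :=
              rowMajor_lt_of_fst_lt (chainCell_lt_of_le (two_le_of_sparse hQ hp₀Q hp hlt)).1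
            exact absurd hj (not_lt.2 this.le)
      by_cases hv : v ∈ Q.image (chainCell n)
      · rw [if_pos (hiff.2 hv), if_pos hv]
      · rw [if_neg (fun h => hv (hiff.1 h)), if_neg hv]
    · push Not at hjr
      rw [ofLex_key_apply_of_forall_ne _ hjr, ofLex_key_apply_of_forall_ne _ hjr]
  · -- at `i`: `0 < 1`
    rw [ofLex_key_apply, ofLex_key_apply, qMono, sqfree_apply, sqfree_apply,
      if_neg (fun h => hp₀bad (mem_offGraph.1 h).2), if_pos (Finset.mem_image_of_mem _ hp₀Q)]
    exact zero_lt_one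

end Minor

/-! ### Linear independence from distinct leading monomials -/

section Independence

variable {K : Type*} [Field K] {n : ℕ}

/-- **GKKS Prop. 11** ("`dim(F-span(S)) = #{LM(f) : f ∈ F-span(S)}` ... a simple application of Gaussian
elimination"), in the form used: polynomials with pairwise distinct designated monomials, each occurring
with nonzero coefficient and dominating in the key order all other monomials of its polynomial, are
linearly independent (look at the maximal designated key with a nonzero coefficient).
[cite: GuptaKamathKayalSaptharishi2014, §5 (Prop. 11)] -/
theorem linearIndependent_of_key {ι : Type*} (g : ι → MvPolynomial (Fin n × Fin n) K)
    (D : ι → (Fin n × Fin n) →₀ ℕ) (hD : Function.Injective D) (hcoeff : ∀ i, coeff (D i) (g i) ≠ 0)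
    (hkey : ∀ i, ∀ e ∈ (g i).support, e ≠ D i → key n e < key n (D i)) : LinearIndependent K g := by
  classical
  rw [linearIndependent_iff']
  intro s c hsum i hi
  by_contra hci
  set s' := s.filter fun j => c j ≠ 0 with hs'
  have hne : s'.Nonempty := ⟨i, Finset.mem_filter.2 ⟨hi, hci⟩⟩
  obtain ⟨j, hj, hjmax⟩ := Finset.exists_max_image s' (fun j => key n (D j)) hne
  obtain ⟨hjs, hcj⟩ := Finset.mem_filter.1 hj
  have h0 : coeff (D j) (∑ i ∈ s, c i • g i) = 0 := by rw [hsum, coeff_zero]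
  rw [coeff_sum, Finset.sum_eq_single_of_mem j hjs] at h0
  · rw [coeff_smul, smul_eq_mul] at h0
    exact hcj ((mul_eq_zero.1 h0).resolve_right (hcoeff j))
  · intro i' hi' hne'
    rw [coeff_smul, smul_eq_mul]
    by_cases hci' : c i' = 0
    · rw [hci', zero_mul]
    · have : coeff (D j) (g i') = 0 := by
        by_contra hsupp
        have hmem : D j ∈ (g i').support := mem_support_iff.2 hsupp
        have hneD : D j ≠ D i' := fun h => hne' (hD h).symm
        have hlt := hkey i' _ hmem hneD
        have hle := hjmax i' (Finset.mem_filter.2 ⟨hi', hci'⟩)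
        exact absurd hlt (not_lt.2 hle)
      rw [this, mul_zero]

end Independence

/-! ### The GKKS family and its size -/

section Family

variable {K : Type*} [Field K] {n k : ℕ}

/-- The cells of the two central diagonals `D_{2,n}`. [cite: GuptaKamathKayalSaptharishi2014, §5.1] -/
def chainCells (n : ℕ) : Finset (Fin n × Fin n) := Finset.univ.image (chainCell n)

/-- Positions allowed in the shift: `Q` and the chain successors of its elements (GKKS's COMPANIONS: "for
`x_{ij} ∈ D_{2,n}` define its companions to be the variables to its right in the same row, or below it in
the same column", restricted to `D_{2,n}`: the chain successor). [cite: GuptaKamathKayalSaptharishi2014, §5 (Lemma 14–15)] -/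
def allowedPos (Q : Finset (Fin (2 * n - 1))) : Finset (Fin (2 * n - 1)) :=
  Q ∪ Finset.univ.filter fun q : Fin (2 * n - 1) => ∃ p ∈ Q, p.val + 1 = q.val

/-- GKKS's usable variables for `Q`: all variables off the two diagonals, the cells of `Q`, and their
companions ("the total number of variables that can be used is at least `n² - (2n-1) + r + (r-1)`"). [cite: GuptaKamathKayalSaptharishi2014, §5 (Lemma 14–15)] -/
def allowed (Q : Finset (Fin (2 * n - 1))) : Finset (Fin n × Fin n) :=
  (Finset.univ \ chainCells n) ∪ (allowedPos Q).image (chainCell n)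

/-- A chain cell is allowed only at an allowed position. [folklore] -/
theorem mem_allowed_chainCell {Q : Finset (Fin (2 * n - 1))} {q : Fin (2 * n - 1)}
    (h : chainCell n q ∈ allowed Q) : q ∈ allowedPos Q := by
  rw [allowed, Finset.mem_union, Finset.mem_sdiff, Finset.mem_image] at h
  rcases h with ⟨-, h⟩ | ⟨p, hp, hpq⟩
  · exact (h (Finset.mem_image_of_mem _ (Finset.mem_univ _))).elim
  · rwa [← chainCell_injective n hpq]

/-- `|allowed Q| ≥ n² - 2n + 2|Q|` for sparse `Q` (GKKS: `n² - (2n-1) + r + (r-1)` usable variables). [cite: GuptaKamathKayalSaptharishi2014, §5 (Lemma 14–15)] -/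
theorem card_allowed_ge {Q : Finset (Fin (2 * n - 1))} (hQ : IsSparse Q) (hn : 1 ≤ n) :
    n * n + 2 * Q.card ≤ (allowed Q).card + 2 * n := by
  classical
  have hchain : (chainCells n).card = 2 * n - 1 := by
    rw [chainCells, Finset.card_image_of_injective _ (chainCell_injective n), Finset.card_univ,
      Fintype.card_fin]
  have hdisj : Disjoint (Finset.univ \ chainCells n) ((allowedPos Q).image (chainCell n)) := by
    rw [Finset.disjoint_left]
    intro v hv hv'
    rw [Finset.mem_sdiff] at hv
    rw [Finset.mem_image] at hv'
    obtain ⟨p, -, rfl⟩ := hv'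
    exact hv.2 (Finset.mem_image_of_mem _ (Finset.mem_univ _))
  have h1 : (allowed Q).card = (n * n - (2 * n - 1)) + (allowedPos Q).card := by
    rw [allowed, Finset.card_union_of_disjoint hdisj, Finset.card_sdiff_of_subset (Finset.subset_univ _),
      Finset.card_univ, Fintype.card_prod, Fintype.card_fin, hchain,
      Finset.card_image_of_injective _ (chainCell_injective n)]
  -- successors of all but possibly one element of `Q`
  set Q' := Q.filter fun p : Fin (2 * n - 1) => p.val + 1 < 2 * n - 1 with hQ'
  have hQ'card : Q.card ≤ Q'.card + 1 := by
    have hsub : ∀ p ∈ Q \ Q', p.val + 1 = 2 * n - 1 := by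
      intro p hp
      rw [Finset.mem_sdiff, hQ', Finset.mem_filter, not_and] at hp
      have := p.2
      have := hp.2 hp.1
      omega
    have hle : (Q \ Q').card ≤ 1 := by
      rw [Finset.card_le_one]
      intro p hp q hq
      have := hsub p hp; have := hsub q hq
      apply Fin.ext; omega
    have := Finset.card_sdiff_add_card_inter Q Q'
    have hint : (Q ∩ Q').card ≤ Q'.card := Finset.card_le_card Finset.inter_subset_right
    omega
  let sc : Fin (2 * n - 1) → Fin (2 * n - 1) := fun p =>
    if h : p.val + 1 < 2 * n - 1 then ⟨p.val + 1, h⟩ else p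
  have hsc : ∀ p ∈ Q', (sc p).val = p.val + 1 := by
    intro p hp
    rw [hQ', Finset.mem_filter] at hp
    simp only [sc, dif_pos hp.2]
  have hscinj : Set.InjOn sc Q' := by
    intro p hp q hq h
    have := congrArg Fin.val h
    rw [hsc p hp, hsc q hq] at this
    exact Fin.ext (by omega)
  have hsub2 : Q ∪ Q'.image sc ⊆ allowedPos Q := by
    intro q hq
    rw [allowedPos, Finset.mem_union]
    rcases Finset.mem_union.1 hq with h | h
    · exact Or.inl h
    · rw [Finset.mem_image] at h
      obtain ⟨p, hp, rfl⟩ := h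
      refine Or.inr (Finset.mem_filter.2 ⟨Finset.mem_univ _, p, (Finset.mem_filter.1 hp).1, ?_⟩)
      rw [hsc p hp]
  have hdisj2 : Disjoint Q (Q'.image sc) := by
    rw [Finset.disjoint_left]
    intro q hq hq'
    rw [Finset.mem_image] at hq'
    obtain ⟨p, hp, hpq⟩ := hq'
    have := hsc p hp
    rw [hpq] at this
    exact hQ p (Finset.mem_filter.1 hp).1 q hq this.symm
  have h2 : Q.card + Q'.card ≤ (allowedPos Q).card := by
    calc Q.card + Q'.card = (Q ∪ Q'.image sc).card := by
          rw [Finset.card_union_of_disjoint hdisj2, Finset.card_image_of_injOn hscinj]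
      _ ≤ (allowedPos Q).card := Finset.card_le_card hsub2
  omega


/-- A monomial in `A.finsuppAntidiag τ` has degree `τ`. [folklore] -/
theorem degree_eq_of_mem_finsuppAntidiag {A : Finset (Fin n × Fin n)} {τ : ℕ} {β : (Fin n × Fin n) →₀ ℕ}
    (h : β ∈ A.finsuppAntidiag τ) : β.degree = τ := by
  rw [Finset.mem_finsuppAntidiag] at h
  rw [Finsupp.degree_apply, ← h.1]
  exact (Finset.sum_subset h.2 (fun v _ hv => Finsupp.notMem_support_iff.1 hv))

/-- The two squeezing conditions of the decoding for `β + x_Q` when `β` is supported on the allowed variables: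
the positions carrying it contain `Q` and lie in `Q ∪ succ Q`. [folklore] -/
theorem subset_conditions_of_add_qMono {Q : Finset (Fin (2 * n - 1))} {β : (Fin n × Fin n) →₀ ℕ}
    (hβ : β.support ⊆ allowed Q) :
    (∀ p ∈ Q, ∃ hm : p.val < 2 * n - 1, (β + qMono Q) (chainCell n ⟨p.val, hm⟩) ≠ 0) ∧
    (∀ m : ℕ, (∃ hm : m < 2 * n - 1, (β + qMono Q) (chainCell n ⟨m, hm⟩) ≠ 0) →
      (∃ p ∈ Q, p.val = m) ∨ (∃ p ∈ Q, p.val + 1 = m)) := by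
  classical
  constructor
  · intro p hp
    refine ⟨p.2, ?_⟩
    simp only [Finsupp.add_apply, qMono, sqfree_apply, Fin.eta,
      if_pos (Finset.mem_image_of_mem (chainCell n) hp)]
    omega
  · rintro m ⟨hm, hne⟩
    simp only [Finsupp.add_apply, qMono, sqfree_apply] at hne
    by_cases hq : chainCell n ⟨m, hm⟩ ∈ Q.image (chainCell n)
    · obtain ⟨p, hp, hpq⟩ := Finset.mem_image.1 hq
      exact Or.inl ⟨p, hp, congrArg Fin.val (chainCell_injective n hpq)⟩
    · rw [if_neg hq, add_zero] at hne
      have hmem : chainCell n ⟨m, hm⟩ ∈ allowed Q := hβ (Finsupp.mem_support_iff.2 hne)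
      have := mem_allowed_chainCell hmem
      rw [allowedPos, Finset.mem_union, Finset.mem_filter] at this
      rcases this with h | ⟨-, p, hp, hpm⟩
      · exact Or.inl ⟨_, h, rfl⟩
      · exact Or.inr ⟨p, hp, hpm⟩

/-- The designated monomials `β + x_Q` determine `Q` and `β` (GKKS Lemma 14: distinct `(Q, β)` give distinct
monomials, "to avoid double counting"). [cite: GuptaKamathKayalSaptharishi2014, §5 (Lemma 14–15)] -/
theorem eq_of_add_qMono_eq {Q Q' : Finset (Fin (2 * n - 1))} (hQ : IsSparse Q) (hQ' : IsSparse Q')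
    {β β' : (Fin n × Fin n) →₀ ℕ} (hβ : β.support ⊆ allowed Q) (hβ' : β'.support ⊆ allowed Q')
    (h : β + qMono Q = β' + qMono Q') : Q = Q' ∧ β = β' := by
  obtain ⟨h1, h2⟩ := subset_conditions_of_add_qMono hβ
  obtain ⟨h1', h2'⟩ := subset_conditions_of_add_qMono hβ'
  rw [← h] at h1' h2'
  have hQQ : Q = Q' := eq_of_sparse_of_subset hQ hQ' h1 h2 h1' h2'
  subst hQQ
  exact ⟨rfl, add_right_cancel h⟩

/-- The other monomials of a shifted minor `x^β M_Q` have smaller keys than `β + x_Q` (translation invariance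
of the lexicographic order). [folklore] -/
theorem key_lt_of_mem_support_shift {Q : Finset (Fin (2 * n - 1))} (hQ : IsSparse Q) (hcard : Q.card + k = n)
    (β : (Fin n × Fin n) →₀ ℕ) {e : (Fin n × Fin n) →₀ ℕ}
    (he : e ∈ (monomial β (1 : K) * qMinor K Q hQ hcard).support) (hne : e ≠ β + qMono Q) :
    key n e < key n (β + qMono Q) := by
  obtain ⟨hle, hmem⟩ := le_and_mem_support_of_mem_support_monomial_mul _ _ he
  have he' : e = β + (e - β) := (add_tsub_cancel_of_le hle).symm
  have hne' : e - β ≠ qMono Q := by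
    intro h; apply hne; rw [he', h]
  have hlt := key_lt_key_qMono hQ hcard hmem hne'
  rw [he', key_add, key_add, add_comm (key n β), add_comm (key n β)]
  exact add_lt_add_left hlt (key n β)

/-- **The GKKS lower bound (Gupta–Kamath–Kayal–Saptharishi 2014, Cor. 16, for the determinant; used by
ELSW §6, Case C4):** `dim I^{det_n,k}_{n-k+τ} ≥ binom(n+k, 2k) · binom(n² - 2k + τ - 1, τ)`: the shifted
minors `x^β · M_Q` — `Q` an `(n-k)`-increasing sequence in the two central diagonals, `β` of degree `τ`
in the variables off the diagonals, of `Q`, and of the companions of `Q` — have pairwise distinct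
leading monomials. (GKKS count monomials of degree `≤ n-k+ℓ`; the printed `binom(n²+τ-2k, τ)` of ELSW
is the at-most-degree count, the exact-degree count is `binom(n²-2k+τ-1, τ)`.) Any field, `k ≤ n`, `1 ≤ n`.
[cite: GuptaKamathKayalSaptharishi2014, §5 (Cor. 16)] -/
theorem gkks_bound (K : Type*) [Field K] {n k : ℕ} (hk : k ≤ n) (hn : 1 ≤ n) (τ : ℕ) :
    (n + k).choose (2 * k) * (n * n - 2 * k + τ - 1).choose τ ≤
      shiftedPartialsRank K k τ (Literature.Computability.AlgebraicComplexity.detPoly (Fin n) K) := by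
  classical
  set s := n - k with hs
  set D := Literature.Computability.AlgebraicComplexity.detPoly (Fin n) K with hD
  set Qs := (Finset.univ : Finset (Finset (Fin (2 * n - 1)))).filter (fun Q => IsSparse Q ∧ Q.card = s)
    with hQs
  set I := Qs.sigma (fun Q => (allowed Q).finsuppAntidiag τ) with hI
  let g : I → MvPolynomial (Fin n × Fin n) K := fun x =>
    monomial x.1.2 (1 : K) * (if h : IsSparse x.1.1 ∧ x.1.1.card + k = n then
      qMinor K x.1.1 h.1 h.2 else 0)
  let Dm : I → (Fin n × Fin n) →₀ ℕ := fun x => x.1.2 + qMono x.1.1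
  have hx : ∀ x : I, IsSparse x.1.1 ∧ x.1.1.card + k = n ∧ x.1.2 ∈ (allowed x.1.1).finsuppAntidiag τ := by
    intro x
    have h1 := Finset.mem_sigma.1 x.2
    have h2 := (Finset.mem_filter.1 h1.1).2
    exact ⟨h2.1, by rw [h2.2]; omega, h1.2⟩
  have hg : ∀ x : I, g x = monomial x.1.2 (1 : K) * qMinor K x.1.1 (hx x).1 (hx x).2.1 := by
    intro x; simp only [g, dif_pos (And.intro (hx x).1 (hx x).2.1)]
  have hDinj : Function.Injective Dm := by
    intro x y hxy
    obtain ⟨hQQ, hββ⟩ := eq_of_add_qMono_eq (hx x).1 (hx y).1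
      (Finset.mem_finsuppAntidiag.1 (hx x).2.2).2 (Finset.mem_finsuppAntidiag.1 (hx y).2.2).2 hxy
    exact Subtype.ext (Sigma.ext hQQ (heq_of_eq hββ))
  have hcoeff : ∀ x : I, coeff (Dm x) (g x) ≠ 0 := by
    intro x
    rw [hg x]
    simp only [Dm, coeff_monomial_mul', if_pos (self_le_add_right x.1.2 (qMono x.1.1)), one_mul,
      add_tsub_cancel_left]
    exact coeff_qMono_qMinor_ne_zero _ _ _
  have hkey : ∀ x : I, ∀ e ∈ (g x).support, e ≠ Dm x → key n e < key n (Dm x) := by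
    intro x e he hne
    rw [hg x] at he
    exact key_lt_of_mem_support_shift (hx x).1 (hx x).2.1 x.1.2 he hne
  have hli : LinearIndependent K g := linearIndependent_of_key g Dm hDinj hcoeff hkey
  have hspan : Submodule.span K (Set.range g) ≤ Submodule.span K (shiftedPartials k τ D) := by
    rw [Submodule.span_le]
    rintro _ ⟨x, rfl⟩
    rw [SetLike.mem_coe, hg x]
    obtain ⟨l, hl, hlq⟩ := qMinor_mem_derivSet (K := K) x.1.1 (hx x).1 (hx x).2.1
    exact Submodule.subset_span ⟨l, x.1.2, hl, degree_eq_of_mem_finsuppAntidiag (hx x).2.2, by rw [hlq]⟩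
  haveI := finite_span_shiftedPartials (K := K) k τ D
  have hrank : Fintype.card I ≤ shiftedPartialsRank K k τ D := by
    rw [← finrank_span_eq_card hli]
    exact Submodule.finrank_mono hspan
  refine le_trans ?_ ((Fintype.card_coe I) ▸ hrank)
  rw [hI, Finset.card_sigma]
  have hQcount : (n + k).choose (2 * k) ≤ Qs.card := by
    have := choose_le_card_sparse (2 * n - 1) s (by omega)
    rw [show 2 * n - 1 + 1 - s = n + k by omega] at this
    rw [show 2 * k = n + k - s by omega, Nat.choose_symm (show s ≤ n + k by omega)]
    exact this
  calc (n + k).choose (2 * k) * (n * n - 2 * k + τ - 1).choose τ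
      ≤ Qs.card * (n * n - 2 * k + τ - 1).choose τ := Nat.mul_le_mul_right _ hQcount
    _ = ∑ _Q ∈ Qs, (n * n - 2 * k + τ - 1).choose τ := by rw [Finset.sum_const, smul_eq_mul]
    _ ≤ ∑ Q ∈ Qs, ((allowed Q).finsuppAntidiag τ).card := by
        refine Finset.sum_le_sum fun Q hQ => ?_
        rw [hQs, Finset.mem_filter] at hQ
        rw [Finset.card_finsuppAntidiag_nat_eq_choose]
        refine Nat.choose_le_choose τ ?_
        have := card_allowed_ge hQ.2.1 hn
        rw [hQ.2.2] at this
        omega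

end Family

end Literature.Barriers.ValiantsHypothesis
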